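import Summits.CriticalPhenomena.PercolationContinuityZ3.Theorems.PercNearOneGluingNoHeavyLowerTailSahiCombTriWFaceMin

/-!
# The two-level split of `TRI_W(a)` along a coordinate of the cube

Support file of the one-cut programme (crux `NoHeavyLowerTail`, stmt-CriticalPhenomena-4575; cell `prim-masterthm`, seat P5 gen 17;
memo `FROM-prim-masterthm-p5-g17-FACE-MIN-INDUCTION.md` §2, §6(e)).  Companion of `…SahiCombTriWFaceMin` (`faceBot`, `faceTop`, `FaceMinIneq`,
`triWIneq_of_faceMinIneq`).

For a coordinate `i` of the cube `Finset γ`, every family of subsets splits into its bottom face (`i ∉ s`) and its top face (`i ∈ s`), both read in the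
cube over `{j // j ≠ i}`; intersections split face by face, and the antipode `refl` SWAPS the faces (`faceBot_refl`, `faceTop_refl`).  Feeding this into
`triWTerm` gives the exact TWO-LEVEL FORM of the triangle functional (memo §6(e)):

  `triW P F G = psi P¹ F¹ G¹ F⁰ G⁰ + psi P⁰ F⁰ G⁰ F¹ G¹`          (`triW_eq_psi_faces`)

where `psi S F G F' G' = Σ_x psiTerm …` is `triW` of `S` with DIRECT families `F, G` and ANTIPODAL families `F', G'` — `triWTerm` with every occurrence
under `refl` taken from the primed families (`psiTerm`; `psi S F G F G = triW S F G`, `psi_self`).  So `TRI_W` of an `n`-dimensional instance is the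
`(n−1)`-dimensional two-family functional of the top face with the (smaller) bottom families in the antipodal slots, plus that of the bottom face with the
(larger) top families in the antipodal slots.  This is the identity `T = B + U + Q − R` of the memo in family language; it is the starting point for any
proof of `FaceMinIneq`, and it exhibits the sub-problem (TOP) of the memo: `0 ≤ psi S F G F' G'` whenever `F' x ⊆ F x`, `G' x ⊆ G x`
(= `TriWIneq` for up-sets inside a top face).

* `faceLift_injective`, `not_mem_faceLift`, `compl_faceLift`, `compl_insert_faceLift` — bookkeeping for the face embedding;
* `faceBot_inter`, `faceTop_inter`, **`faceBot_refl`**, **`faceTop_refl`** — faces commute with `∩` and swap under `refl`;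
* **`card_eq_card_faceBot_add_card_faceTop`** — `#𝒜 = #(faceBot i 𝒜) + #(faceTop i 𝒜)`;
* `psiTerm`, `psi`, `psi_self` — the two-family functional;
* **`triWTerm_eq_psiTerm_faces`**, **`triW_eq_psi_faces`** — the split identity (no hypothesis on `P, F, G`).
HONEST LABEL: definitions and unconditional identities (pure bookkeeping); nothing here proves `FaceMinIneq` or `TriWIneq`. [this work]
-/

namespace Summit.CriticalPhenomena.PercolationContinuityZ3.Theorems

namespace FiveUpSet

open Finset

variable {β γ : Type} [DecidableEq β] [Fintype β] [DecidableEq γ] [Fintype γ]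

/-! ### Bookkeeping for the face embedding -/

omit [DecidableEq γ] [Fintype γ] in
/-- `faceLift i` is injective. [this work] -/
theorem faceLift_injective (i : γ) : Function.Injective (faceLift i) :=
  fun _ _ h => (map_injective (Function.Embedding.subtype _)).eq_iff.1 h

omit [DecidableEq γ] [Fintype γ] in
/-- A lifted face set does not contain `i`. [this work] -/
theorem not_mem_faceLift (i : γ) (s : Finset {j : γ // j ≠ i}) : i ∉ faceLift i s := by
  intro h
  rw [faceLift, mem_map] at h
  obtain ⟨j, -, hj⟩ := h
  exact j.2 hj

omit [DecidableEq γ] [Fintype γ] in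
/-- Membership of a point `j ≠ i` in a lifted face set. [this work] -/
theorem mem_faceLift_iff (i : γ) (s : Finset {j : γ // j ≠ i}) (j : γ) (hj : j ≠ i) :
    j ∈ faceLift i s ↔ (⟨j, hj⟩ : {j : γ // j ≠ i}) ∈ s := by
  rw [faceLift, mem_map]
  constructor
  · rintro ⟨k, hk, hkj⟩
    have : k = ⟨j, hj⟩ := Subtype.ext hkj
    rw [← this]; exact hk
  · intro h
    exact ⟨⟨j, hj⟩, h, rfl⟩

/-- The complement (in `γ`) of a lifted face set is `i` together with the lift of the complement (in `{j // j ≠ i}`). [this work] -/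
theorem compl_faceLift (i : γ) (s : Finset {j : γ // j ≠ i}) : (faceLift i s)ᶜ = insert i (faceLift i sᶜ) := by
  ext j
  rw [mem_compl, mem_insert]
  by_cases hj : j = i
  · subst hj
    simp only [not_mem_faceLift, not_false_eq_true, true_or]
  · rw [mem_faceLift_iff i s j hj, mem_faceLift_iff i sᶜ j hj, mem_compl]
    simp [hj]

/-- The complement of `insert i (faceLift i s)` is the lift of the complement. [this work] -/
theorem compl_insert_faceLift (i : γ) (s : Finset {j : γ // j ≠ i}) : (insert i (faceLift i s))ᶜ = faceLift i sᶜ := by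
  rw [← compl_compl (faceLift i sᶜ), compl_faceLift, compl_compl]

/-! ### Faces commute with intersections and swap under the antipode -/

/-- `faceBot i (𝒜 ∩ ℬ) = faceBot i 𝒜 ∩ faceBot i ℬ`. [this work] -/
theorem faceBot_inter (i : γ) (𝒜 ℬ : Finset (Finset γ)) : faceBot i (𝒜 ∩ ℬ) = faceBot i 𝒜 ∩ faceBot i ℬ := by
  ext s; simp only [mem_faceBot, mem_inter]

/-- `faceTop i (𝒜 ∩ ℬ) = faceTop i 𝒜 ∩ faceTop i ℬ`. [this work] -/
theorem faceTop_inter (i : γ) (𝒜 ℬ : Finset (Finset γ)) : faceTop i (𝒜 ∩ ℬ) = faceTop i 𝒜 ∩ faceTop i ℬ := by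
  ext s; simp only [mem_faceTop, mem_inter]

/-- **The antipode swaps the faces**: `faceBot i (refl 𝒜) = refl (faceTop i 𝒜)`. [this work] -/
theorem faceBot_refl (i : γ) (𝒜 : Finset (Finset γ)) : faceBot i (refl 𝒜) = refl (faceTop i 𝒜) := by
  ext s
  rw [mem_faceBot, mem_refl, mem_refl, mem_faceTop, compl_faceLift]

/-- `faceTop i (refl 𝒜) = refl (faceBot i 𝒜)`. [this work] -/
theorem faceTop_refl (i : γ) (𝒜 : Finset (Finset γ)) : faceTop i (refl 𝒜) = refl (faceBot i 𝒜) := by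
  ext s
  rw [mem_faceTop, mem_refl, mem_refl, mem_faceBot, compl_insert_faceLift]

/-! ### Splitting a cardinality along the coordinate -/

/-- The bottom face, lifted back, is the part of the family avoiding `i`. [this work] -/
theorem map_faceBot (i : γ) (𝒜 : Finset (Finset γ)) :
    (faceBot i 𝒜).map ⟨faceLift i, faceLift_injective i⟩ = 𝒜.filter (fun t => i ∉ t) := by
  ext t
  rw [mem_map, mem_filter]
  constructor
  · rintro ⟨s, hs, rfl⟩
    rw [mem_faceBot] at hs
    exact ⟨hs, not_mem_faceLift i s⟩
  · rintro ⟨ht, hit⟩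
    refine ⟨t.subtype (fun j => j ≠ i), ?_, ?_⟩
    · rw [mem_faceBot]
      have h : faceLift i (t.subtype (fun j => j ≠ i)) = t := by
        rw [faceLift, subtype_map, filter_eq_self]
        intro j hj hji; exact hit (hji ▸ hj)
      rw [h]; exact ht
    · show faceLift i (t.subtype (fun j => j ≠ i)) = t
      rw [faceLift, subtype_map, filter_eq_self]
      intro j hj hji; exact hit (hji ▸ hj)

omit [Fintype γ] in
/-- The top-face embedding `s ↦ insert i (faceLift i s)` is injective. [this work] -/
theorem insert_faceLift_injective (i : γ) : Function.Injective (fun s : Finset {j : γ // j ≠ i} => insert i (faceLift i s)) := by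
  intro s t h
  have h' : (insert i (faceLift i s)).erase i = (insert i (faceLift i t)).erase i := by
    simp only at h
    rw [h]
  rw [erase_insert (not_mem_faceLift i s), erase_insert (not_mem_faceLift i t)] at h'
  exact faceLift_injective i h'

/-- The top face, lifted back, is the part of the family containing `i`. [this work] -/
theorem map_faceTop (i : γ) (𝒜 : Finset (Finset γ)) :
    (faceTop i 𝒜).map ⟨fun s => insert i (faceLift i s), insert_faceLift_injective i⟩ = 𝒜.filter (fun t => i ∈ t) := by
  ext t
  rw [mem_map, mem_filter]
  constructor
  · rintro ⟨s, hs, rfl⟩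
    rw [mem_faceTop] at hs
    exact ⟨hs, mem_insert_self i _⟩
  · rintro ⟨ht, hit⟩
    have h : faceLift i ((t.erase i).subtype (fun j => j ≠ i)) = t.erase i := by
      rw [faceLift, subtype_map, filter_eq_self]
      intro j hj hji; rw [hji] at hj; exact (notMem_erase i t) hj
    refine ⟨(t.erase i).subtype (fun j => j ≠ i), ?_, ?_⟩
    · rw [mem_faceTop, h, insert_erase hit]; exact ht
    · show insert i (faceLift i ((t.erase i).subtype (fun j => j ≠ i))) = t
      rw [h, insert_erase hit]

/-- **`#𝒜 = #(faceBot i 𝒜) + #(faceTop i 𝒜)`** — a family splits into its two faces along `i`. [this work] -/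
theorem card_eq_card_faceBot_add_card_faceTop (i : γ) (𝒜 : Finset (Finset γ)) :
    𝒜.card = (faceBot i 𝒜).card + (faceTop i 𝒜).card := by
  rw [← card_map ⟨faceLift i, faceLift_injective i⟩, ← card_map ⟨_, insert_faceLift_injective i⟩, map_faceBot, map_faceTop,
    add_comm]
  exact (card_filter_add_card_filter_not (fun t => i ∈ t)).symm

/-! ### The two-family functional and the split identity -/

/-- The summand of the TWO-FAMILY triangle functional: `triWTerm` of `S` with direct families `F, G` and antipodal families `F', G'` (every occurrence
under `refl` is primed): `2·#(S ∩ F x ∩ G x) − #(S ∩ refl(F' x) ∩ G xᶜ) − #(S ∩ F x ∩ refl(G' xᶜ)) − #(S ∩ refl(F' x) ∩ refl(G' x)) + #(S ∩ refl(F' x) ∩ refl(G' xᶜ))`. [this work] -/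
def psiTerm (S : Finset (Finset γ)) (F G F' G' : Finset β → Finset (Finset γ)) (x : Finset β) : ℤ :=
  2 * ((S ∩ F x ∩ G x).card : ℤ) - (S ∩ refl (F' x) ∩ G xᶜ).card - (S ∩ F x ∩ refl (G' xᶜ)).card
    - (S ∩ refl (F' x) ∩ refl (G' x)).card + (S ∩ refl (F' x) ∩ refl (G' xᶜ)).card

/-- The two-family triangle functional `psi S F G F' G' = Σ_x psiTerm S F G F' G' x` (memo §6(e): `Ψ(S; (F,G) | (F',G'))`). [this work] -/
def psi (S : Finset (Finset γ)) (F G F' G' : Finset β → Finset (Finset γ)) : ℤ :=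
  ∑ x : Finset β, psiTerm S F G F' G' x

/-- With equal direct and antipodal families, `psi` is `triW`. [this work] -/
theorem psi_self (S : Finset (Finset γ)) (F G : Finset β → Finset (Finset γ)) : psi S F G F G = triW S F G := rfl

/-- **The split of `triWTerm` along `i`**: the top face with the bottom families in the antipodal slots, plus the bottom face with the top families
in the antipodal slots. [this work] -/
theorem triWTerm_eq_psiTerm_faces (i : γ) (P : Finset (Finset γ)) (F G : Finset β → Finset (Finset γ)) (x : Finset β) :
    triWTerm P F G x
      = psiTerm (faceTop i P) (fun y => faceTop i (F y)) (fun y => faceTop i (G y)) (fun y => faceBot i (F y)) (fun y => faceBot i (G y)) x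
      + psiTerm (faceBot i P) (fun y => faceBot i (F y)) (fun y => faceBot i (G y)) (fun y => faceTop i (F y)) (fun y => faceTop i (G y)) x := by
  unfold triWTerm psiTerm
  rw [card_eq_card_faceBot_add_card_faceTop i (P ∩ F x ∩ G x), card_eq_card_faceBot_add_card_faceTop i (P ∩ refl (F x) ∩ G xᶜ),
    card_eq_card_faceBot_add_card_faceTop i (P ∩ F x ∩ refl (G xᶜ)), card_eq_card_faceBot_add_card_faceTop i (P ∩ refl (F x) ∩ refl (G x)),
    card_eq_card_faceBot_add_card_faceTop i (P ∩ refl (F x) ∩ refl (G xᶜ))]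
  simp only [faceBot_inter, faceTop_inter, faceBot_refl, faceTop_refl]
  push_cast
  ring

/-- **Two-level form of `TRI_W(a)`** (memo §6(e)): `triW P F G = psi P¹ F¹ G¹ F⁰ G⁰ + psi P⁰ F⁰ G⁰ F¹ G¹` with `⁰/¹` the bottom/top faces along `i`.
No hypothesis on `P, F, G`. [this work] -/
theorem triW_eq_psi_faces (i : γ) (P : Finset (Finset γ)) (F G : Finset β → Finset (Finset γ)) :
    triW P F G
      = psi (faceTop i P) (fun y => faceTop i (F y)) (fun y => faceTop i (G y)) (fun y => faceBot i (F y)) (fun y => faceBot i (G y))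
      + psi (faceBot i P) (fun y => faceBot i (F y)) (fun y => faceBot i (G y)) (fun y => faceTop i (F y)) (fun y => faceTop i (G y)) := by
  unfold triW psi
  rw [← sum_add_distrib]
  exact sum_congr rfl fun x _ => triWTerm_eq_psiTerm_faces i P F G x

end FiveUpSet

end Summit.CriticalPhenomena.PercolationContinuityZ3.Theorems
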